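import Literature.Computability.Complexity.AverageCaseDepthHierarchyTypNum
import HarnessLib

/-!
# RST Theorem 1: the parameters for `m` sufficiently large (asymptotics, part A)

B. Rossman, R. A. Servedio, L.-Y. Tan, *An average-case depth hierarchy theorem for Boolean
circuits*, arXiv:1504.03398 [RossmanServedioTan2015], §6–§7 (pp. 15–16: `w = ⌊m 2^m ln 2⌋`,
`q = 2^{-m/2}`, `λ = (log w)^{3/2} w^{-5/4}`, `w₀ = 2^m ln 2 (1 ± o(1))`, Lemma 7.1), and the
"for `m` sufficiently large" steps of §10 (pp. 32–36).

This file turns "`m` sufficiently large" into thresholds: a master lemma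
(`eventually_small`: `C m^k 2^{-m/a} ≤ 1` for `m ≥ m₀(k,a,C)`), crude two-sided bounds on
`w, log₂ w, λ, w₀, Δ_j` (`§1`), and from them the elementary facts `RegimeFacts m d`
(`regimeFacts_of`) and `TypFacts m d E` (`typFacts_of`, `E = ⌊w^{4/5}⌋`) and the bias window
(`bias_window`) used by `agreement_le`, for all `m ≥ m₀` and `2 ≤ d ≤ c m / log₂ m`, where the
constant `c` and the inputs `|t_k - q| ≤ q^{1.1}` (Lemma 7.1) and `w₀ = 2^m ln 2 (1 ± 1/2)` come from
the landed `rossmanServedioTan2015_lem71_holds` and `rossmanServedioTan2015_w0_asymp_holds`.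
-/

noncomputable section

namespace Literature.Computability.Complexity

namespace RSTProj

open Finset Real

/-! ### §0 The master threshold lemma -/

/-- `C m^k 2^{-m/a} ≤ 1` for all `m ≥ m₀`. [folklore] -/
theorem eventually_small (k : ℕ) {a C : ℝ} (ha : 0 < a) :
    ∃ m₀ : ℕ, ∀ m : ℕ, m₀ ≤ m → C * (m : ℝ) ^ k * (2 : ℝ) ^ (-(m : ℝ) / a) ≤ 1 := by
  have hρ : 1 < (2 : ℝ) ^ (1 / a) := Real.one_lt_rpow one_lt_two (by positivity)
  have hlim := (tendsto_pow_const_div_const_pow_of_one_lt k hρ).const_mul C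
  rw [mul_zero] at hlim
  obtain ⟨m₀, hm₀⟩ := Filter.eventually_atTop.mp (hlim.eventually_lt_const one_pos)
  refine ⟨m₀, fun m hm => ?_⟩
  have h := hm₀ m hm
  have e : (2 : ℝ) ^ (-(m : ℝ) / a) = (((2 : ℝ) ^ (1 / a)) ^ m)⁻¹ := by
    rw [← Real.rpow_natCast, ← Real.rpow_mul (by norm_num), ← Real.rpow_neg (by norm_num)]
    congr 1
    ring
  rw [e]
  calc C * (m : ℝ) ^ k * (((2 : ℝ) ^ (1 / a)) ^ m)⁻¹ = C * ((m : ℝ) ^ k / ((2 : ℝ) ^ (1 / a)) ^ m) := by ring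
    _ ≤ 1 := h.le

/-- Two thresholds at once. [folklore] -/
theorem eventually_and {P Q : ℕ → Prop} (hP : ∃ m₀ : ℕ, ∀ m, m₀ ≤ m → P m) (hQ : ∃ m₀ : ℕ, ∀ m, m₀ ≤ m → Q m) :
    ∃ m₀ : ℕ, ∀ m, m₀ ≤ m → P m ∧ Q m := by
  obtain ⟨a, ha⟩ := hP; obtain ⟨b, hb⟩ := hQ
  exact ⟨max a b, fun m hm => ⟨ha m (le_trans (le_max_left _ _) hm), hb m (le_trans (le_max_right _ _) hm)⟩⟩

/-! ### §1 Crude bounds on the parameters -/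

/-- Powers of two: `2^a · 2^b = 2^{a+b}`, monotonicity, positivity. [folklore] -/
theorem two_rpow_add (a b : ℝ) : (2 : ℝ) ^ a * (2 : ℝ) ^ b = (2 : ℝ) ^ (a + b) := (Real.rpow_add two_pos a b).symm

/-- Monotonicity of `2^x`. [folklore] -/
theorem two_rpow_le {a b : ℝ} (h : a ≤ b) : (2 : ℝ) ^ a ≤ (2 : ℝ) ^ b := Real.rpow_le_rpow_of_exponent_le one_le_two h

/-- Positivity of `2^x`. [folklore] -/
theorem two_rpow_pos (a : ℝ) : 0 < (2 : ℝ) ^ a := Real.rpow_pos_of_pos two_pos a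

/-- `q = 2^{-m/2}`, `p = q² = 2^{-m}`, `q³ = 2^{-3m/2}`. [cite: RossmanServedioTan2015, §7.1 (p. 16)] -/
theorem rstQ_eq (m : ℕ) : rstQ m = (2 : ℝ) ^ (-(m : ℝ) / 2) := rfl

/-- `q ≤ 1`. [cite: RossmanServedioTan2015, §7.1 (p. 16)] -/
theorem rstQ_le_one (m : ℕ) : rstQ m ≤ 1 := by
  rw [rstQ_eq]; exact Real.rpow_le_one_of_one_le_of_nonpos one_le_two (by
    have : (0:ℝ) ≤ m := Nat.cast_nonneg m; linarith)

/-- `2^m ≤ w ≤ m 2^m` for `m ≥ 2`. [cite: RossmanServedioTan2015, §6 (p. 15, `w = ⌊m 2^m ln 2⌋`)] -/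
theorem rstW_bounds {m : ℕ} (hm : 2 ≤ m) : (2 : ℝ) ^ (m : ℝ) ≤ rstW m ∧ (rstW m : ℝ) ≤ m * (2 : ℝ) ^ (m : ℝ) := by
  have hL1 := Real.log_two_gt_d9
  have hL2 := Real.log_two_lt_d9
  have hm' : (2 : ℝ) ≤ m := by exact_mod_cast hm
  have hw1 := rstW_gt m
  have hw2 := rstW_le m
  have h2m : (2 : ℝ) ^ (m : ℝ) = 2 ^ m := Real.rpow_natCast 2 m
  have hM : (4 : ℝ) ≤ 2 ^ m := by
    calc (4 : ℝ) = 2 ^ 2 := by norm_num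
      _ ≤ 2 ^ m := pow_le_pow_right₀ (by norm_num) hm
  rw [h2m]
  constructor
  · have h : (2 : ℝ) * 2 ^ m * 0.6931471803 ≤ m * 2 ^ m * Real.log 2 :=
      mul_le_mul (mul_le_mul_of_nonneg_right hm' (by positivity)) hL1.le (by norm_num) (by positivity)
    nlinarith
  · calc (rstW m : ℝ) ≤ m * 2 ^ m * Real.log 2 := hw2
      _ ≤ m * 2 ^ m * 1 := mul_le_mul_of_nonneg_left (by linarith) (by positivity)
      _ = m * 2 ^ m := mul_one _

/-- `1 ≤ w`, `0 < w`. [folklore] -/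
theorem rstW_pos {m : ℕ} (hm : 2 ≤ m) : (1 : ℝ) ≤ rstW m ∧ (0 : ℝ) < rstW m := by
  have h := (rstW_bounds hm).1
  have h1 : (1 : ℝ) ≤ (2 : ℝ) ^ (m : ℝ) := Real.one_le_rpow one_le_two (Nat.cast_nonneg m)
  exact ⟨h1.trans h, lt_of_lt_of_le (by linarith) h⟩

/-- `m ≤ log₂ w ≤ 2m` for `m ≥ 2`. [folklore] -/
theorem logb_rstW_bounds {m : ℕ} (hm : 2 ≤ m) : (m : ℝ) ≤ Real.logb 2 (rstW m) ∧ Real.logb 2 (rstW m) ≤ 2 * m := by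
  obtain ⟨h1, h2⟩ := rstW_bounds hm
  have hw := (rstW_pos hm).2
  have hm' : (2 : ℝ) ≤ m := by exact_mod_cast hm
  constructor
  · rw [Real.le_logb_iff_rpow_le one_lt_two hw]; exact h1
  · rw [Real.logb_le_iff_le_rpow one_lt_two hw]
    refine h2.trans ?_
    have hmle : (m : ℝ) ≤ (2 : ℝ) ^ (m : ℝ) := by
      have := Real.rpow_natCast 2 m
      rw [this]
      exact_mod_cast (Nat.lt_two_pow_self).le
    calc (m : ℝ) * (2 : ℝ) ^ (m : ℝ) ≤ (2 : ℝ) ^ (m : ℝ) * (2 : ℝ) ^ (m : ℝ) :=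
          mul_le_mul_of_nonneg_right hmle (two_rpow_pos _).le
      _ = (2 : ℝ) ^ (2 * (m : ℝ)) := by rw [two_rpow_add]; ring_nf

/-- `2^{-5m/4} ≤ λ ≤ 4 m² 2^{-5m/4}` (the lower bound from `log₂ w ≥ m ≥ 1`, `w ≤ 2^{2m}`… crudely
`λ ≥ w^{-5/4} ≥ 2^{-5m/2}` suffices for us). [cite: RossmanServedioTan2015, §7.1 (p. 16)] -/
theorem rstLam_ge {m : ℕ} (hm : 2 ≤ m) : (2 : ℝ) ^ (-(5 * (m : ℝ) / 2)) ≤ rstLam m := by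
  obtain ⟨hl1, hl2⟩ := logb_rstW_bounds hm
  obtain ⟨hw1, hw2⟩ := rstW_bounds hm
  have hw := (rstW_pos hm).2
  have hm' : (2 : ℝ) ≤ m := by exact_mod_cast hm
  unfold rstLam
  rw [le_div_iff₀ (Real.rpow_pos_of_pos hw _)]
  -- numerator `≥ 1`, and `2^{-5m/2} w^{5/4} ≤ 1`
  have hnum : (1 : ℝ) ≤ Real.logb 2 (rstW m) ^ ((3 : ℝ) / 2) := Real.one_le_rpow (by linarith) (by norm_num)
  have hden : (rstW m : ℝ) ^ ((5 : ℝ) / 4) ≤ (2 : ℝ) ^ (5 * (m : ℝ) / 2) := by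
    have hw22 : (rstW m : ℝ) ≤ (2 : ℝ) ^ (2 * (m : ℝ)) := by
      rw [Real.logb_le_iff_le_rpow one_lt_two hw] at hl2; exact hl2
    calc (rstW m : ℝ) ^ ((5 : ℝ) / 4) ≤ ((2 : ℝ) ^ (2 * (m : ℝ))) ^ ((5 : ℝ) / 4) :=
          Real.rpow_le_rpow (Nat.cast_nonneg _) hw22 (by norm_num)
      _ = (2 : ℝ) ^ (5 * (m : ℝ) / 2) := by rw [← Real.rpow_mul two_pos.le]; ring_nf
  calc (2 : ℝ) ^ (-(5 * (m : ℝ) / 2)) * (rstW m : ℝ) ^ ((5 : ℝ) / 4)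
      ≤ (2 : ℝ) ^ (-(5 * (m : ℝ) / 2)) * (2 : ℝ) ^ (5 * (m : ℝ) / 2) :=
        mul_le_mul_of_nonneg_left hden (two_rpow_pos _).le
    _ = 1 := by rw [two_rpow_add]; norm_num
    _ ≤ _ := hnum

/-- `w λ ≤ (2m)^{3/2} w^{-1/4} ≤ 4 m^{2} 2^{-m/4}`. [folklore] -/
theorem rstW_mul_rstLam_le {m : ℕ} (hm : 2 ≤ m) : (rstW m : ℝ) * rstLam m ≤ 4 * (m : ℝ) ^ 2 * (2 : ℝ) ^ (-(m : ℝ) / 4) := by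
  obtain ⟨hl1, hl2⟩ := logb_rstW_bounds hm
  obtain ⟨hw1, hw2⟩ := rstW_bounds hm
  have hw := (rstW_pos hm).2
  have hm' : (2 : ℝ) ≤ m := by exact_mod_cast hm
  have e : (rstW m : ℝ) * rstLam m = Real.logb 2 (rstW m) ^ ((3 : ℝ) / 2) * (rstW m : ℝ) ^ (-(1 : ℝ) / 4) := by
    unfold rstLam
    rw [mul_div_assoc', div_eq_iff (Real.rpow_pos_of_pos hw _).ne', mul_assoc, ← Real.rpow_add hw]
    norm_num
    rw [mul_comm]
  rw [e]
  have h1 : Real.logb 2 (rstW m) ^ ((3 : ℝ) / 2) ≤ (2 * m) ^ ((3 : ℝ) / 2) :=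
    Real.rpow_le_rpow (by linarith) hl2 (by norm_num)
  have h2 : (2 * (m : ℝ)) ^ ((3 : ℝ) / 2) ≤ 4 * (m : ℝ) ^ 2 := by
    have : (2 * (m : ℝ)) ^ ((3 : ℝ) / 2) ≤ (2 * (m : ℝ)) ^ (2 : ℝ) :=
      Real.rpow_le_rpow_of_exponent_le (by linarith) (by norm_num)
    rw [Real.rpow_two] at this
    nlinarith
  have h3 : (rstW m : ℝ) ^ (-(1 : ℝ) / 4) ≤ (2 : ℝ) ^ (-(m : ℝ) / 4) := by
    rw [show (-(1 : ℝ) / 4) = -((1 : ℝ) / 4) by ring, Real.rpow_neg (Nat.cast_nonneg _),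
      show (-(m : ℝ) / 4) = -((m : ℝ) / 4) by ring, Real.rpow_neg two_pos.le,
      inv_le_inv₀ (Real.rpow_pos_of_pos hw _) (two_rpow_pos _)]
    calc (2 : ℝ) ^ ((m : ℝ) / 4) = ((2 : ℝ) ^ (m : ℝ)) ^ ((1 : ℝ) / 4) := by rw [← Real.rpow_mul two_pos.le]; ring_nf
      _ ≤ (rstW m : ℝ) ^ ((1 : ℝ) / 4) := Real.rpow_le_rpow (two_rpow_pos _).le hw1 (by norm_num)
  calc Real.logb 2 (rstW m) ^ ((3 : ℝ) / 2) * (rstW m : ℝ) ^ (-(1 : ℝ) / 4)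
      ≤ (4 * (m : ℝ) ^ 2) * (2 : ℝ) ^ (-(m : ℝ) / 4) :=
        mul_le_mul (h1.trans h2) h3 (Real.rpow_nonneg (Nat.cast_nonneg _) _) (by positivity)
    _ = _ := by ring

/-- `Δ_j ≤ w^{5/12}` for every `j`, and `w^{1/3} ≤ Δ_j` for `j + 2 ≤ d`. [cite: RossmanServedioTan2015, §7.2 Def. 8 (p. 17, `1/3 ≤ β < 5/12`)] -/
theorem rstDelta_bounds {m d : ℕ} (hm : 2 ≤ m) (hd : 2 ≤ d) (j : ℕ) :
    rstDelta m d j ≤ (rstW m : ℝ) ^ ((5 : ℝ) / 12) ∧ (j + 2 ≤ d → (rstW m : ℝ) ^ ((1 : ℝ) / 3) ≤ rstDelta m d j) := by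
  have hw1 := (rstW_pos hm).1
  have hd' : (2 : ℝ) ≤ d := by exact_mod_cast hd
  have hdpos : (0 : ℝ) < d := by linarith
  unfold rstDelta
  constructor
  · apply Real.rpow_le_rpow_of_exponent_le hw1
    have hj : (0 : ℝ) ≤ j := Nat.cast_nonneg j
    have : ((d : ℝ) - 2 - j) / (12 * d) ≤ 1 / 12 := by
      rw [div_le_iff₀ (by positivity : (0:ℝ) < 12 * d)]; linarith
    linarith
  · intro hj2
    apply Real.rpow_le_rpow_of_exponent_le hw1
    have : (0 : ℝ) ≤ ((d : ℝ) - 2 - j) / (12 * d) := by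
      apply div_nonneg _ (by positivity)
      have : ((j + 2 : ℕ) : ℝ) ≤ d := by exact_mod_cast hj2
      push_cast at this; linarith
    linarith

/-- `Δ_j = w^{1/(12d)} Δ_{j+1}`. [cite: RossmanServedioTan2015, §7.2 Def. 8 (p. 17)] -/
theorem rstDelta_succ {m d : ℕ} (hm : 2 ≤ m) (hd : 2 ≤ d) (j : ℕ) :
    rstDelta m d j = (rstW m : ℝ) ^ (1 / (12 * (d : ℝ))) * rstDelta m d (j + 1) := by
  have hw := (rstW_pos hm).2
  unfold rstDelta
  rw [← Real.rpow_add hw]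
  congr 1
  have hd2 : (2 : ℝ) ≤ d := by exact_mod_cast hd
  have hd' : (0 : ℝ) < d := by linarith
  field_simp
  push_cast
  ring

/-- `1.2 · 2^m ≤ w` for `m ≥ 3`. [folklore] -/
theorem rstW_ge {m : ℕ} (hm : 3 ≤ m) : (1.2 : ℝ) * (2 : ℝ) ^ (m : ℝ) ≤ rstW m := by
  have hL1 := Real.log_two_gt_d9
  have hm' : (3 : ℝ) ≤ m := by exact_mod_cast hm
  have hw1 := rstW_gt m
  have h2m : (2 : ℝ) ^ (m : ℝ) = 2 ^ m := Real.rpow_natCast 2 m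
  have hM : (8 : ℝ) ≤ 2 ^ m := by
    calc (8 : ℝ) = 2 ^ 3 := by norm_num
      _ ≤ 2 ^ m := pow_le_pow_right₀ (by norm_num) hm
  rw [h2m]
  have h : (3 : ℝ) * 2 ^ m * 0.6931471803 ≤ m * 2 ^ m * Real.log 2 :=
    mul_le_mul (mul_le_mul_of_nonneg_right hm' (by positivity)) hL1.le (by norm_num) (by positivity)
  nlinarith

/-- `(m 2^m)^e = m^e 2^{e m}`. [folklore] -/
theorem mul_two_rpow_rpow (m : ℕ) (e : ℝ) : ((m : ℝ) * (2 : ℝ) ^ (m : ℝ)) ^ e = (m : ℝ) ^ e * (2 : ℝ) ^ (e * m) := by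
  rw [Real.mul_rpow (Nat.cast_nonneg _) (two_rpow_pos _).le, ← Real.rpow_mul two_pos.le]
  ring_nf

/-- `w^e ≤ m^e 2^{em}` for `e ≥ 0`, `m ≥ 2`. [folklore] -/
theorem rstW_rpow_le {m : ℕ} (hm : 2 ≤ m) {e : ℝ} (he : 0 ≤ e) :
    (rstW m : ℝ) ^ e ≤ (m : ℝ) ^ e * (2 : ℝ) ^ (e * m) := by
  rw [← mul_two_rpow_rpow]
  exact Real.rpow_le_rpow (Nat.cast_nonneg _) (rstW_bounds hm).2 he

/-- `2^{em} ≤ w^e` for `e ≥ 0`, `m ≥ 2`. [folklore] -/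
theorem rstW_rpow_ge {m : ℕ} (hm : 2 ≤ m) {e : ℝ} (he : 0 ≤ e) : (2 : ℝ) ^ (e * m) ≤ (rstW m : ℝ) ^ e := by
  calc (2 : ℝ) ^ (e * m) = ((2 : ℝ) ^ (m : ℝ)) ^ e := by rw [← Real.rpow_mul two_pos.le]; ring_nf
    _ ≤ (rstW m : ℝ) ^ e := Real.rpow_le_rpow (two_rpow_pos _).le (rstW_bounds hm).1 he

/-- `m^e ≤ m` for `0 ≤ e ≤ 1`, `1 ≤ m`. [folklore] -/
theorem natCast_rpow_le_self {m : ℕ} (hm : 1 ≤ m) {e : ℝ} (he1 : e ≤ 1) : (m : ℝ) ^ e ≤ m := by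
  have hm' : (1 : ℝ) ≤ m := by exact_mod_cast hm
  calc (m : ℝ) ^ e ≤ (m : ℝ) ^ (1 : ℝ) := Real.rpow_le_rpow_of_exponent_le hm' he1
    _ = m := Real.rpow_one _

/-- `λ ≥ w^{-5/4} ≥ m^{-5/4} 2^{-5m/4}`. [cite: RossmanServedioTan2015, §7.1 (p. 16)] -/
theorem rstLam_ge' {m : ℕ} (hm : 2 ≤ m) : (m : ℝ) ^ (-(5 : ℝ) / 4) * (2 : ℝ) ^ (-(5 * (m : ℝ) / 4)) ≤ rstLam m := by
  obtain ⟨hl1, hl2⟩ := logb_rstW_bounds hm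
  have hw := (rstW_pos hm).2
  have hm' : (2 : ℝ) ≤ m := by exact_mod_cast hm
  have hm0 : (0 : ℝ) < m := by linarith
  unfold rstLam
  rw [le_div_iff₀ (Real.rpow_pos_of_pos hw _)]
  have hnum : (1 : ℝ) ≤ Real.logb 2 (rstW m) ^ ((3 : ℝ) / 2) := Real.one_le_rpow (by linarith) (by norm_num)
  have hden : (rstW m : ℝ) ^ ((5 : ℝ) / 4) ≤ (m : ℝ) ^ ((5 : ℝ) / 4) * (2 : ℝ) ^ ((5 : ℝ) / 4 * m) := rstW_rpow_le hm (by norm_num)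
  have e : (m : ℝ) ^ (-(5 : ℝ) / 4) * (2 : ℝ) ^ (-(5 * (m : ℝ) / 4)) * ((m : ℝ) ^ ((5 : ℝ) / 4) * (2 : ℝ) ^ ((5 : ℝ) / 4 * m)) = 1 := by
    calc _ = ((m : ℝ) ^ (-(5 : ℝ) / 4) * (m : ℝ) ^ ((5 : ℝ) / 4)) * ((2 : ℝ) ^ (-(5 * (m : ℝ) / 4)) * (2 : ℝ) ^ ((5 : ℝ) / 4 * m)) := by ring
      _ = 1 := by
          rw [← Real.rpow_add hm0, two_rpow_add]
          norm_num
          ring_nf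
          simp
  calc (m : ℝ) ^ (-(5 : ℝ) / 4) * (2 : ℝ) ^ (-(5 * (m : ℝ) / 4)) * (rstW m : ℝ) ^ ((5 : ℝ) / 4)
      ≤ (m : ℝ) ^ (-(5 : ℝ) / 4) * (2 : ℝ) ^ (-(5 * (m : ℝ) / 4)) * ((m : ℝ) ^ ((5 : ℝ) / 4) * (2 : ℝ) ^ ((5 : ℝ) / 4 * m)) :=
        mul_le_mul_of_nonneg_left hden (by positivity)
    _ = 1 := e
    _ ≤ _ := hnum

/-! ### §2 The regime `2 ≤ d ≤ c m / log₂ m` and the thresholds -/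

/-- Consequences of the regime with `c ≤ 1/64`: `m ≥ 128`, `d log₂ m ≤ m/64`, `d ≤ m`,
`log₂ m ≥ 1`. [cite: RossmanServedioTan2015, Lemma 7.1 (p. 16; App. 12, p. 41)] -/
theorem regime_basic {m d : ℕ} {c : ℝ} (hc : c ≤ 1 / 64) (hd : 2 ≤ d) (hdc : (d : ℝ) ≤ c * m / Real.logb 2 m) :
    128 ≤ m ∧ (d : ℝ) * Real.logb 2 m ≤ m / 64 ∧ d ≤ m ∧ 1 ≤ Real.logb 2 (m : ℝ) := by
  have hd2 : (2 : ℝ) ≤ d := by exact_mod_cast hd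
  have hm2 : 2 ≤ m := by
    rcases Nat.lt_or_ge m 2 with h | h
    · exfalso
      have h0 : c * m / Real.logb 2 m = 0 := by
        interval_cases m <;> simp
      rw [h0] at hdc
      linarith
    · exact h
  have hm2' : (2 : ℝ) ≤ m := by exact_mod_cast hm2
  have hm0 : (0 : ℝ) < m := by linarith
  have hlogm1 : 1 ≤ Real.logb 2 (m : ℝ) := by
    rw [Real.le_logb_iff_rpow_le one_lt_two hm0, Real.rpow_one]
    exact hm2'
  have hlogpos : 0 < Real.logb 2 (m : ℝ) := by linarith
  have hdlog : (d : ℝ) * Real.logb 2 m ≤ m / 64 := by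
    have h1 := (le_div_iff₀ hlogpos).mp hdc
    have h2 : c * m ≤ (1 / 64) * m := mul_le_mul_of_nonneg_right hc hm0.le
    linarith
  have hlog_le : Real.logb 2 (m : ℝ) ≤ m / 128 := by
    have : 2 * Real.logb 2 (m : ℝ) ≤ d * Real.logb 2 m := mul_le_mul_of_nonneg_right hd2 hlogpos.le
    linarith
  have hm128 : (128 : ℝ) ≤ m := by linarith
  have hdm : (d : ℝ) ≤ m := by
    have : (d : ℝ) * 1 ≤ d * Real.logb 2 m := mul_le_mul_of_nonneg_left hlogm1 (by linarith)
    linarith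
  exact ⟨by exact_mod_cast hm128, hdlog, by exact_mod_cast hdm, hlogm1⟩

/-- In the regime, `2^{m/(12d)} ≥ m^5`. [folklore] -/
theorem two_rpow_div_ge {m d : ℕ} (hm0 : (0 : ℝ) < m) (hd : (0 : ℝ) < d)
    (hdlog : (d : ℝ) * Real.logb 2 m ≤ m / 64) : (m : ℝ) ^ (5 : ℝ) ≤ (2 : ℝ) ^ ((m : ℝ) / (12 * d)) := by
  have e : (m : ℝ) ^ (5 : ℝ) = (2 : ℝ) ^ (5 * Real.logb 2 m) := by
    rw [mul_comm, Real.rpow_mul two_pos.le, Real.rpow_logb two_pos (by norm_num) hm0]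
  rw [e]
  apply two_rpow_le
  rw [le_div_iff₀ (by positivity)]
  nlinarith

/-- The crude "`m` is large" inequalities used below. [folklore] -/
structure Small (m : ℕ) : Prop where
  s1 : 16 * (m : ℝ) ^ 3 * (2 : ℝ) ^ (-(m : ℝ) / 4) ≤ 1
  s2 : 64 * (m : ℝ) ^ 1 * (2 : ℝ) ^ (-(m : ℝ) / 12) ≤ 1
  s3 : 8 * (m : ℝ) ^ 1 * (2 : ℝ) ^ (-(m : ℝ) / 5) ≤ 1
  s4 : 4 * (m : ℝ) ^ 1 * (2 : ℝ) ^ (-(m : ℝ) / 30) ≤ 1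
  s5 : 2500 * (m : ℝ) ^ 3 * (2 : ℝ) ^ (-(m : ℝ) / 20) ≤ 1
  s6 : 192 * (m : ℝ) ^ 3 * (2 : ℝ) ^ (-(m : ℝ) / 6) ≤ 1
  s7 : 96 * (m : ℝ) ^ 1 * (2 : ℝ) ^ (-(m : ℝ) / 24) ≤ 1
  s8 : 24 * (m : ℝ) ^ 3 * (2 : ℝ) ^ (-(m : ℝ) / (24 / 5)) ≤ 1
  s9 : 12 * (m : ℝ) ^ 3 * (2 : ℝ) ^ (-(m : ℝ) / 2) ≤ 1
  s10 : 2304 * (m : ℝ) ^ 2 * (2 : ℝ) ^ (-(m : ℝ) / 4) ≤ 1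
  s11 : 12 * (m : ℝ) ^ 1 * (2 : ℝ) ^ (-(m : ℝ) / (10 / 3)) ≤ 1
  s12 : 6 * (m : ℝ) ^ 2 * (2 : ℝ) ^ (-(m : ℝ) / (5 / 4)) ≤ 1

/-- `Small m` for all large `m`. [folklore] -/
theorem small_eventually : ∃ m₀ : ℕ, ∀ m : ℕ, m₀ ≤ m → Small m := by
  obtain ⟨m₀, h⟩ := eventually_and (eventually_small 3 (a := 4) (C := 16) (by norm_num))
    (eventually_and (eventually_small 1 (a := 12) (C := 64) (by norm_num))
    (eventually_and (eventually_small 1 (a := 5) (C := 8) (by norm_num))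
    (eventually_and (eventually_small 1 (a := 30) (C := 4) (by norm_num))
    (eventually_and (eventually_small 3 (a := 20) (C := 2500) (by norm_num))
    (eventually_and (eventually_small 3 (a := 6) (C := 192) (by norm_num))
    (eventually_and (eventually_small 1 (a := 24) (C := 96) (by norm_num))
    (eventually_and (eventually_small 3 (a := 24 / 5) (C := 24) (by norm_num))
    (eventually_and (eventually_small 3 (a := 2) (C := 12) (by norm_num))
    (eventually_and (eventually_small 2 (a := 4) (C := 2304) (by norm_num))
    (eventually_and (eventually_small 1 (a := 10 / 3) (C := 12) (by norm_num))
    (eventually_small 2 (a := 5 / 4) (C := 6) (by norm_num))))))))))))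
  exact ⟨m₀, fun m hm => by
    obtain ⟨h1, h2, h3, h4, h5, h6, h7, h8, h9, h10, h11, h12⟩ := h m hm
    exact ⟨h1, h2, h3, h4, h5, h6, h7, h8, h9, h10, h11, h12⟩⟩

/-- **`RegimeFacts` for large `m` in the regime.** [cite: RossmanServedioTan2015, §7.1 Lemma 7.1 (p. 16) and §10.1 (p. 32)] -/
theorem regimeFacts_of {m d : ℕ} (hm : 128 ≤ m) (hd : 2 ≤ d) (hS : Small m)
    (h71 : ∀ k, 1 ≤ k → k ≤ d - 1 → |rstT m d k - rstQ m| ≤ rstQ m ^ (1.1 : ℝ)) : RegimeFacts m d := by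
  have hm2 : 2 ≤ m := le_trans (by norm_num) hm
  have hm4 : 4 ≤ m := le_trans (by norm_num) hm
  have hm' : (128 : ℝ) ≤ m := by exact_mod_cast hm
  have hm1 : (1 : ℝ) ≤ m := by linarith
  have hq := rstQ_pos m
  -- `q ≤ 1/16`
  have hq16 : rstQ m ≤ 1 / 16 := by
    rw [rstQ_eq]
    calc (2 : ℝ) ^ (-(m : ℝ) / 2) ≤ (2 : ℝ) ^ (-(4 : ℝ)) := two_rpow_le (by linarith)
      _ = 1 / 16 := by rw [Real.rpow_neg two_pos.le]; norm_num
  -- `q^{1.1} ≤ q/2`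
  have hq11 : rstQ m ^ (1.1 : ℝ) ≤ rstQ m / 2 := by
    rw [show (1.1 : ℝ) = 1 + 0.1 by norm_num, Real.rpow_add hq, Real.rpow_one]
    have : rstQ m ^ (0.1 : ℝ) ≤ 1 / 2 := by
      rw [rstQ_eq, ← Real.rpow_mul two_pos.le]
      calc (2 : ℝ) ^ (-(m : ℝ) / 2 * 0.1) ≤ (2 : ℝ) ^ (-(1 : ℝ)) := two_rpow_le (by linarith)
        _ = 1 / 2 := by rw [Real.rpow_neg two_pos.le, Real.rpow_one]; norm_num
    calc rstQ m * rstQ m ^ (0.1 : ℝ) ≤ rstQ m * (1 / 2) := mul_le_mul_of_nonneg_left this hq.le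
      _ = rstQ m / 2 := by ring
  refine ⟨hd, hq16, lt_of_lt_of_le (two_rpow_pos _) (rstLam_ge hm2), ?_, fun k hk1 hkd => ?_, fun j => ?_⟩
  · -- `λ ≤ p/2`
    have h := rstLam_le m hm4
    have hs := hS.s1
    rw [rstQ_sq]
    have e : (4 : ℝ) * m ^ 2 * (2 : ℝ) ^ (-(5 * (m : ℝ) / 4)) = (8 * (m : ℝ) ^ 2 * (2 : ℝ) ^ (-(m : ℝ) / 4)) * (rstP m / 2) := by
      unfold rstP; rw [show -(5 * (m : ℝ) / 4) = -(m : ℝ) / 4 + -(m : ℝ) by ring, ← two_rpow_add]; ring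
    rw [e] at h
    have h8 : 8 * (m : ℝ) ^ 2 * (2 : ℝ) ^ (-(m : ℝ) / 4) ≤ 1 := by
      have : (m : ℝ) ^ 2 ≤ (m : ℝ) ^ 3 := by nlinarith
      nlinarith [two_rpow_pos (-(m : ℝ) / 4)]
    have hp := rstP_pos m
    nlinarith
  · -- `t_k ∈ [q/2, 2q]`
    have h := abs_le.1 (h71 k hk1 hkd)
    constructor <;> linarith
  · -- `64 q Δ_j ≤ 1`
    have hΔ := (rstDelta_bounds hm2 hd j).1
    have hw := rstW_rpow_le hm2 (e := (5 : ℝ) / 12) (by norm_num)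
    have hm512 : (m : ℝ) ^ ((5 : ℝ) / 12) ≤ m := natCast_rpow_le_self (by omega) (by norm_num)
    have hs := hS.s2
    simp only [pow_one] at hs
    have e : rstQ m * (2 : ℝ) ^ ((5 : ℝ) / 12 * m) = (2 : ℝ) ^ (-(m : ℝ) / 12) := by
      rw [rstQ_eq, two_rpow_add]; ring_nf
    have hΔ0 : 0 ≤ rstDelta m d j := Real.rpow_nonneg (Nat.cast_nonneg _) _
    calc 64 * rstQ m * rstDelta m d j ≤ 64 * rstQ m * ((m : ℝ) ^ ((5 : ℝ) / 12) * (2 : ℝ) ^ ((5 : ℝ) / 12 * m)) :=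
          mul_le_mul_of_nonneg_left (hΔ.trans hw) (by positivity)
      _ = 64 * (m : ℝ) ^ ((5 : ℝ) / 12) * (rstQ m * (2 : ℝ) ^ ((5 : ℝ) / 12 * m)) := by ring
      _ ≤ 64 * m * (2 : ℝ) ^ (-(m : ℝ) / 12) := by
          rw [e]; exact mul_le_mul_of_nonneg_right (mul_le_mul_of_nonneg_left hm512 (by norm_num)) (two_rpow_pos _).le
      _ ≤ 1 := hs

/-- `q w^{5/12} ≤ 1/64` and `q ≤ 1/64` for large `m`. [folklore] -/
theorem q_rstW_small {m : ℕ} (hm : 128 ≤ m) (hS : Small m) :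
    rstQ m * (rstW m : ℝ) ^ ((5 : ℝ) / 12) ≤ 1 / 64 ∧ rstQ m ≤ 1 / 64 := by
  have hm2 : 2 ≤ m := le_trans (by norm_num) hm
  have hm' : (128 : ℝ) ≤ m := by exact_mod_cast hm
  have hw := rstW_rpow_le hm2 (e := (5 : ℝ) / 12) (by norm_num)
  have hm512 : (m : ℝ) ^ ((5 : ℝ) / 12) ≤ m := natCast_rpow_le_self (by omega) (by norm_num)
  have hs := hS.s2
  simp only [pow_one] at hs
  have hq := rstQ_pos m
  have e : rstQ m * (2 : ℝ) ^ ((5 : ℝ) / 12 * m) = (2 : ℝ) ^ (-(m : ℝ) / 12) := by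
    rw [rstQ_eq, two_rpow_add]; ring_nf
  constructor
  · calc rstQ m * (rstW m : ℝ) ^ ((5 : ℝ) / 12) ≤ rstQ m * ((m : ℝ) ^ ((5 : ℝ) / 12) * (2 : ℝ) ^ ((5 : ℝ) / 12 * m)) :=
          mul_le_mul_of_nonneg_left hw hq.le
      _ = (m : ℝ) ^ ((5 : ℝ) / 12) * (2 : ℝ) ^ (-(m : ℝ) / 12) := by rw [← e]; ring
      _ ≤ m * (2 : ℝ) ^ (-(m : ℝ) / 12) := mul_le_mul_of_nonneg_right hm512 (two_rpow_pos _).le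
      _ ≤ 1 / 64 := by linarith
  · rw [rstQ_eq]
    calc (2 : ℝ) ^ (-(m : ℝ) / 2) ≤ (2 : ℝ) ^ (-(6 : ℝ)) := two_rpow_le (by linarith)
      _ = 1 / 64 := by rw [Real.rpow_neg two_pos.le]; norm_num

/-! ### §3 `TypFacts` for large `m` -/

/-- **`TypFacts` for large `m` in the regime**, with `E = ⌊w^{4/5}⌋` and
`w₀ ∈ [2^m/4, 1.1 · 2^m]`. [cite: RossmanServedioTan2015, §10.1 (pp. 32–34)] -/
theorem typFacts_of {m d : ℕ} (hm : 128 ≤ m) (hd : 2 ≤ d) (hS : Small m)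
    (hdlog : (d : ℝ) * Real.logb 2 m ≤ m / 64)
    (hw0lo : (2 : ℝ) ^ (m : ℝ) / 4 ≤ rstW0 m d) (hw0hi : (rstW0 m d : ℝ) ≤ 1.1 * (2 : ℝ) ^ (m : ℝ)) :
    TypFacts m d ⌊(rstW m : ℝ) ^ ((4 : ℝ) / 5)⌋₊ := by
  have hm2 : 2 ≤ m := le_trans (by norm_num) hm
  have hm3 : 3 ≤ m := le_trans (by norm_num) hm
  have hm' : (128 : ℝ) ≤ m := by exact_mod_cast hm
  have hm0 : (0 : ℝ) < m := by linarith
  have hd' : (2 : ℝ) ≤ d := by exact_mod_cast hd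
  have hq := rstQ_pos m
  have h2m := two_rpow_pos (m : ℝ)
  obtain ⟨hw1, hwpos⟩ := rstW_pos hm2
  have hwge := rstW_ge hm3
  -- `w₀ ≤ w`, `0 < w₀`
  have hw0w : (rstW0 m d : ℝ) ≤ rstW m := by linarith
  have hw0pos : (0 : ℝ) < rstW0 m d := by linarith
  -- `E ≤ w^{4/5} ≤ m 2^{4m/5}`
  set E := ⌊(rstW m : ℝ) ^ ((4 : ℝ) / 5)⌋₊ with hE
  have hE1 : (E : ℝ) ≤ (rstW m : ℝ) ^ ((4 : ℝ) / 5) := Nat.floor_le (Real.rpow_nonneg (Nat.cast_nonneg _) _)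
  have hE2 : (rstW m : ℝ) ^ ((4 : ℝ) / 5) ≤ m * (2 : ℝ) ^ ((4 : ℝ) / 5 * m) :=
    (rstW_rpow_le hm2 (by norm_num)).trans (mul_le_mul_of_nonneg_right (natCast_rpow_le_self (by omega) (by norm_num)) (two_rpow_pos _).le)
  have hE0 : (0 : ℝ) ≤ E := Nat.cast_nonneg _
  -- `2E ≤ 2^m/4 ≤ w₀`
  have hs3 := hS.s3
  simp only [pow_one] at hs3
  have h2E : 2 * (E : ℝ) ≤ (2 : ℝ) ^ (m : ℝ) / 4 := by
    have e : (m : ℝ) * (2 : ℝ) ^ ((4 : ℝ) / 5 * m) = (m * (2 : ℝ) ^ (-(m : ℝ) / 5)) * (2 : ℝ) ^ (m : ℝ) := by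
      rw [mul_assoc, two_rpow_add]; ring_nf
    have : (E : ℝ) ≤ (m * (2 : ℝ) ^ (-(m : ℝ) / 5)) * (2 : ℝ) ^ (m : ℝ) := by rw [← e]; exact hE1.trans hE2
    nlinarith
  -- `Δ_j ≤ m 2^{5m/12} ≤ q w₀ / 2`
  have hs2 := hS.s2
  simp only [pow_one] at hs2
  have hΔle : ∀ j, rstDelta m d j ≤ rstQ m * rstW0 m d / 2 := by
    intro j
    have h1 := (rstDelta_bounds hm2 hd j).1
    have h2 : (rstW m : ℝ) ^ ((5 : ℝ) / 12) ≤ m * (2 : ℝ) ^ ((5 : ℝ) / 12 * m) :=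
      (rstW_rpow_le hm2 (by norm_num)).trans (mul_le_mul_of_nonneg_right (natCast_rpow_le_self (by omega) (by norm_num)) (two_rpow_pos _).le)
    have e : (m : ℝ) * (2 : ℝ) ^ ((5 : ℝ) / 12 * m) = (8 * m * (2 : ℝ) ^ (-(m : ℝ) / 12)) * (rstQ m * ((2 : ℝ) ^ (m : ℝ) / 4) / 2) := by
      rw [rstQ_eq]
      have : (2 : ℝ) ^ ((5 : ℝ) / 12 * m) = (2 : ℝ) ^ (-(m : ℝ) / 12) * ((2 : ℝ) ^ (-(m : ℝ) / 2) * (2 : ℝ) ^ (m : ℝ)) := by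
        rw [two_rpow_add, two_rpow_add]; ring_nf
      rw [this]; ring
    have h3 : rstQ m * ((2 : ℝ) ^ (m : ℝ) / 4) / 2 ≤ rstQ m * rstW0 m d / 2 := by nlinarith
    have h4 : (8 * m * (2 : ℝ) ^ (-(m : ℝ) / 12)) * (rstQ m * ((2 : ℝ) ^ (m : ℝ) / 4) / 2) ≤
        1 * (rstQ m * ((2 : ℝ) ^ (m : ℝ) / 4) / 2) :=
      mul_le_mul_of_nonneg_right (by linarith) (by positivity)
    linarith
  refine ⟨by exact_mod_cast hw0w, by exact_mod_cast hw0pos, by omega, ?_, hΔle, fun j hj => (rstDelta_bounds hm2 hd j).2 hj, ?_⟩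
  · -- `2E ≤ w₀` in `ℕ`
    have : ((2 * E : ℕ) : ℝ) ≤ rstW0 m d := by push_cast; linarith
    exact_mod_cast this
  · -- `q w (16 q Δ_{j+1}) + q E ≤ Δ_j / 2`
    intro j hj
    have hΔ0 : 0 ≤ rstDelta m d (j + 1) := Real.rpow_nonneg (Nat.cast_nonneg _) _
    have hratio := rstDelta_succ hm2 hd j
    have hpow : (m : ℝ) ^ (5 : ℝ) ≤ (rstW m : ℝ) ^ (1 / (12 * (d : ℝ))) := by
      refine (two_rpow_div_ge hm0 (by linarith) hdlog).trans ?_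
      have := rstW_rpow_ge hm2 (e := 1 / (12 * (d : ℝ))) (by positivity)
      rwa [show 1 / (12 * (d : ℝ)) * m = (m : ℝ) / (12 * d) by ring] at this
    have hm5 : 64 * (m : ℝ) ≤ (m : ℝ) ^ (5 : ℝ) := by
      have : (m : ℝ) ^ (5 : ℝ) = (m : ℝ) ^ (5 : ℕ) := by exact_mod_cast Real.rpow_natCast (m : ℝ) 5
      rw [this]; nlinarith [pow_le_pow_left₀ (by norm_num : (0:ℝ) ≤ 128) hm' 4]
    -- `q² w ≤ m`
    have hq2w : rstQ m * rstQ m * rstW m ≤ m := by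
      rw [← sq, rstQ_sq]
      have := (rstW_bounds hm2).2
      have e : rstP m * (m * (2 : ℝ) ^ (m : ℝ)) = m := by
        rw [Real.rpow_natCast, ← mul_assoc, mul_comm (rstP m), mul_assoc, rstP_mul_two_pow, mul_one]
      nlinarith [rstP_pos m]
    have hA : rstQ m * rstW m * (16 * rstQ m * rstDelta m d (j + 1)) ≤ rstDelta m d j / 4 := by
      rw [hratio]
      have : rstQ m * rstW m * (16 * rstQ m * rstDelta m d (j + 1)) = 16 * (rstQ m * rstQ m * rstW m) * rstDelta m d (j + 1) := by ring
      rw [this]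
      nlinarith [mul_le_mul_of_nonneg_right (hm5.trans hpow) hΔ0, mul_le_mul_of_nonneg_right hq2w hΔ0]
    have hB : rstQ m * E ≤ rstDelta m d j / 4 := by
      have hge := (rstDelta_bounds hm2 hd j).2 (by omega)
      have hw3 := rstW_rpow_ge hm2 (e := (1 : ℝ) / 3) (by norm_num)
      have hs4 := hS.s4
      simp only [pow_one] at hs4
      have e : rstQ m * (m * (2 : ℝ) ^ ((4 : ℝ) / 5 * m)) = (4 * m * (2 : ℝ) ^ (-(m : ℝ) / 30)) * ((2 : ℝ) ^ ((1 : ℝ) / 3 * m) / 4) := by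
        have e1 : rstQ m * (2 : ℝ) ^ ((4 : ℝ) / 5 * m) = (2 : ℝ) ^ (-(m : ℝ) / 30) * (2 : ℝ) ^ ((1 : ℝ) / 3 * m) := by
          rw [rstQ_eq, two_rpow_add, two_rpow_add]
          congr 1; ring
        calc rstQ m * (m * (2 : ℝ) ^ ((4 : ℝ) / 5 * m)) = m * (rstQ m * (2 : ℝ) ^ ((4 : ℝ) / 5 * m)) := by ring
          _ = m * ((2 : ℝ) ^ (-(m : ℝ) / 30) * (2 : ℝ) ^ ((1 : ℝ) / 3 * m)) := by rw [e1]
          _ = _ := by ring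
      have h1 : rstQ m * E ≤ (4 * m * (2 : ℝ) ^ (-(m : ℝ) / 30)) * ((2 : ℝ) ^ ((1 : ℝ) / 3 * m) / 4) := by
        rw [← e]; exact mul_le_mul_of_nonneg_left (hE1.trans hE2) hq.le
      have h2 : (4 * m * (2 : ℝ) ^ (-(m : ℝ) / 30)) * ((2 : ℝ) ^ ((1 : ℝ) / 3 * m) / 4) ≤ 1 * ((2 : ℝ) ^ ((1 : ℝ) / 3 * m) / 4) :=
        mul_le_mul_of_nonneg_right hs4 (by positivity)
      linarith
    linarith

/-! ### §4 The bias window of the last stage -/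

/-- `(1-t)^{q X} = 1/2` for `X = ln 2 / (q (-ln (1-t)))`. [cite: RossmanServedioTan2015, §6 (p. 15, the definition of `w₀`)] -/
theorem half_power {t q : ℝ} (ht0 : 0 < t) (ht1 : t < 1) (hq : 0 < q) :
    (1 - t) ^ (q * (Real.log 2 / (q * -Real.log (1 - t)))) = 1 / 2 := by
  have h1t : 0 < 1 - t := by linarith
  have hℓ : Real.log (1 - t) < 0 := Real.log_neg h1t (by linarith)
  rw [Real.rpow_def_of_pos h1t]
  have e : Real.log (1 - t) * (q * (Real.log 2 / (q * -Real.log (1 - t)))) = -Real.log 2 := by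
    field_simp [hℓ.ne]
  rw [e, Real.exp_neg, Real.exp_log two_pos]
  norm_num

/-- **The bias of the root stays `1/2 ± ε₀`** (RST eq. (14) with the window of (27)): for
`t₁ ∈ [q/2, 2q]` and large `m`, `(1-t₁)^{q w₀ + Δ₀} ≥ 1/2 - ε₀` and `(1-t₁)^{q w₀ - Δ₀} ≤ 1/2 + ε₀`
with `ε₀ = 4 t₁ (Δ₀ + 1)`. [cite: RossmanServedioTan2015, §6 eq. (14) (p. 15) and §10.2 (p. 36)] -/
theorem bias_window {m d : ℕ} (hm : 128 ≤ m) (hd : 2 ≤ d) (hS : Small m)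
    (ht : rstQ m / 2 ≤ rstT m d 1 ∧ rstT m d 1 ≤ 2 * rstQ m) :
    1 / 2 - 4 * rstT m d 1 * (rstDelta m d 0 + 1) ≤ (1 - rstT m d 1) ^ (rstQ m * rstW0 m d + rstDelta m d 0) ∧
      (1 - rstT m d 1) ^ (rstQ m * rstW0 m d - rstDelta m d 0) ≤ 1 / 2 + 4 * rstT m d 1 * (rstDelta m d 0 + 1) ∧
      0 ≤ 4 * rstT m d 1 * (rstDelta m d 0 + 1) := by
  have hm2 : 2 ≤ m := le_trans (by norm_num) hm
  have hq := rstQ_pos m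
  obtain ⟨hqw, hq64⟩ := q_rstW_small hm hS
  set t := rstT m d 1 with htdef
  have ht0 : 0 < t := by linarith
  have ht2 : t ≤ 1 / 2 := by linarith
  have ht1 : t < 1 := by linarith
  have h1t : 0 < 1 - t := by linarith
  have hb1 : 1 - t ≤ 1 := by linarith
  have hΔ0 : 0 ≤ rstDelta m d 0 := Real.rpow_nonneg (Nat.cast_nonneg _) _
  have hΔle : rstDelta m d 0 ≤ (rstW m : ℝ) ^ ((5 : ℝ) / 12) := (rstDelta_bounds hm2 hd 0).1
  -- the window condition `2 t (q + Δ₀) ≤ 1/4`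
  have hcond : 2 * t * (rstQ m + rstDelta m d 0) ≤ 1 / 4 := by
    have : t * rstDelta m d 0 ≤ 2 * (rstQ m * (rstW m : ℝ) ^ ((5 : ℝ) / 12)) := by
      calc t * rstDelta m d 0 ≤ (2 * rstQ m) * (rstW m : ℝ) ^ ((5 : ℝ) / 12) := mul_le_mul ht.2 hΔle hΔ0 (by linarith)
        _ = _ := by ring
    nlinarith [rstQ_le_one m]
  -- `w₀ = ⌈X⌉`, `(1-t)^{qX} = 1/2`
  set X := Real.log 2 / (rstQ m * -Real.log (1 - t)) with hX
  have hℓ : 0 < -Real.log (1 - t) := by have := Real.log_neg h1t (by linarith); linarith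
  have hX0 : 0 ≤ X := div_nonneg (Real.log_pos one_lt_two).le (mul_nonneg hq.le hℓ.le)
  have hw0 : (rstW0 m d : ℝ) = ⌈X⌉₊ := by rw [rstW0_eq_ceil m d ht0 ht1]
  have hw0a : X ≤ rstW0 m d := by rw [hw0]; exact Nat.le_ceil _
  have hw0b : (rstW0 m d : ℝ) < X + 1 := by rw [hw0]; exact Nat.ceil_lt_add_one hX0
  have hhalf : (1 - t) ^ (rstQ m * X) = 1 / 2 := half_power ht0 ht1 hq
  have hsplit : ∀ y : ℝ, (1 - t) ^ (rstQ m * rstW0 m d + y) = 1 / 2 * (1 - t) ^ (rstQ m * (rstW0 m d - X) + y) := by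
    intro y
    rw [← hhalf, ← Real.rpow_add h1t]; ring_nf
  have hδ0 : 0 ≤ rstQ m * (rstW0 m d - X) := mul_nonneg hq.le (by linarith)
  have hδ1 : rstQ m * (rstW0 m d - X) ≤ rstQ m := by nlinarith
  refine ⟨?_, ?_, by positivity⟩
  · -- lower bound
    rw [hsplit]
    have h1 : (1 - t) ^ (rstQ m + rstDelta m d 0) ≤ (1 - t) ^ (rstQ m * (rstW0 m d - X) + rstDelta m d 0) :=
      Real.rpow_le_rpow_of_exponent_ge h1t hb1 (by linarith)
    have h2 := (one_sub_rpow_window ht0.le ht2 (by positivity) hcond (δ := rstQ m + rstDelta m d 0)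
      (abs_le.2 ⟨by linarith [hq, hΔ0], le_rfl⟩)).1
    nlinarith [rstQ_le_one m, mul_nonneg ht0.le hΔ0]
  · -- upper bound
    have e : rstQ m * rstW0 m d - rstDelta m d 0 = rstQ m * rstW0 m d + (-rstDelta m d 0) := by ring
    rw [e, hsplit]
    have h1 : (1 - t) ^ (rstQ m * (rstW0 m d - X) + -rstDelta m d 0) ≤ (1 - t) ^ (-rstDelta m d 0) :=
      Real.rpow_le_rpow_of_exponent_ge h1t hb1 (by linarith)
    have hcond' : 2 * t * rstDelta m d 0 ≤ 1 / 4 := by nlinarith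
    have h2 := (one_sub_rpow_window ht0.le ht2 hΔ0 hcond' (δ := -rstDelta m d 0) (by rw [abs_neg, abs_of_nonneg hΔ0])).2
    have h3 : 0 ≤ (1 - t) ^ (rstQ m * (rstW0 m d - X) + -rstDelta m d 0) := Real.rpow_nonneg h1t.le _
    nlinarith [mul_nonneg ht0.le hΔ0]

end RSTProj

end Literature.Computability.Complexity

end
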